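import Literature.NumberTheory.EllipticCurves.H1UnramifiedFinite
import Literature.NumberTheory.EllipticCurves.H1CorestrictionIndexTwo
import HarnessLib

/-!
# Route `PrintCFram`, crux C2 `BottomClassIndexLawFiveLe` (stmt-BirchSwinnertonDyer-20372), line
# `eisenstein-resource-bdp-line` (LEAD g10, report §2(d)): **THE LEVEL DICTIONARY (α), CORE** — projecting a
# locally trivial class of `H¹(Γ, M)` along `0 → S → M → Q → 0` to an everywhere-unramified class of
# `H¹(Γ, Q)` or of `H¹(Γ, S)`
# (cell `bsd-print-cfram`, width seat `bsd-line-cfram-p1-w4` g8; helper `--supports` 20372; 0 defs, 0 facts,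
# 0 sorry)

HONEST FRAMING. Nothing about BSD is proved here, and nothing of any stub; this is pure continuous group
cohomology in degree one, on explicit continuous crossed homomorphisms
(`GaloisRepresentations.contOneCocycles (discreteTopRep G ·)`, classes by `oneCocycleClass`, «coboundary on a
subgroup `I`» written `∃ v, ∀ g ∈ I, z g = g • v − v`, which is membership of the class in
`subgroupResKer · I` by `oneCocycleClass_mem_subgroupResKer_iff`). It is layer (α-core) of LEAD g10's LEVEL
DICTIONARY (report `Lines/eisenstein-resource-bdp-line-lead-g10.md` §2(d)): in the application `Γ = Γ_ℚ`,
`M = W[p]`, `S = Φ = W[𝔭]` the rational line, `Q = W[p]/Φ`, `z` the Kummer cocycle of a generator `P` of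
`W(ℚ)` of LEVEL ≥ 1 (`p ∣ P` in `W(ℚ_p)`), and the family `𝓘` consists of the inertia groups at the primes
`ℓ ≠ p` together with a decomposition group at `p`.

* `exists_preimage_cocycle` — if `π ∘ z` vanishes identically for a continuous crossed homomorphism
  `z : G → M`, then `z = ι ∘ w` for a continuous crossed homomorphism `w : G → S` (exactness of
  `S → M → Q` in the middle, `ι` injective and equivariant).
* **`unramified_quot_or_sub_of_locally_trivial`** — (α-core). `G` a topological group, `S, M, Q` discrete
  `G`-modules with continuous orbit maps on `M`, `ι : S → M`, `π : M → Q` equivariant, `ι` injective, `π`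
  surjective, `ker π = im ι`; `𝓘` a family of subgroups of `G` such that for each `I ∈ 𝓘` EITHER `Q^I = 0` OR
  `I` acts trivially on `M`. Then every continuous crossed homomorphism `z : G → M` whose class is non-zero
  but restricts to zero on every `I ∈ 𝓘` yields EITHER the class of `π ∘ z` in `H¹(G, Q)`, non-zero and
  restricting to zero on every `I ∈ 𝓘`, OR a continuous crossed homomorphism `w : G → S` with non-zero class
  restricting to zero on every `I ∈ 𝓘` and `ι ∘ w = z − ∂m₁` for some `m₁ ∈ M`.
  PROOF. `π ∘ z` restricts to `∂(π v_I)` on `I`. If its class vanishes, `π ∘ z = ∂q₀`; lift `q₀ = π m₁`; then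
  `z − ∂m₁` takes values in `ker π = ι(S)`, so it is `ι ∘ w`; `[w] ≠ 0` since `[z] ≠ 0`; on `I ∈ 𝓘`,
  `ι ∘ w = ∂u` with `π u ∈ Q^I`: if `Q^I = 0` then `u = ι s₀` and `w = ∂s₀` on `I`; if `I` acts trivially on
  `M` then `w = 0` on `I`.
* `apply_eq_zero_of_coboundaryOn_of_forall_smul_eq` — a crossed homomorphism that is a coboundary on `I`
  kills every `g ∈ I` acting trivially (the reading «kills `N ∩ I`» of the engines' currency).

THEOREMS ONLY; no definition, no named fact, no `sorry`. BSD is not proved by any of this; no summit statement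
is proved by this seat. References: [SerreGaloisCohomology1997] I.§2.2, I.§2.6 (b), I.§5.1 (cocycles,
inflation–restriction, principal crossed homomorphisms); Greenberg, LNM 1716 (1999) §3 (residual Selmer groups
of the sub and quotient characters, PDF p. 86); the LEAD g10 report §2(a)–(d).
-/

set_option autoImplicit false
-- `…BirchSwinnertonDyer.BirchSwinnertonDyer.Theorems…` is the problem's mandated namespace (D-0017).
set_option linter.dupNamespace false

noncomputable section

open scoped Classical

namespace Summit.BirchSwinnertonDyer.BirchSwinnertonDyer.Theorems.PrintCFram.LevelDictionary

open Literature.NumberTheory.EllipticCurves Literature.NumberTheory.GaloisRepresentations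

universe u

variable {G : Type u} [Group G] [TopologicalSpace G] [IsTopologicalGroup G]
variable {S M Q : Type u} [AddCommGroup S] [AddCommGroup M] [AddCommGroup Q]
  [DistribMulAction G S] [DistribMulAction G M] [DistribMulAction G Q]
  [TopologicalSpace S] [DiscreteTopology S] [TopologicalSpace M] [DiscreteTopology M]
  [TopologicalSpace Q] [DiscreteTopology Q]

/-! ## §1 Cocycle calculus: push-forward along `π`, coboundaries on a subgroup -/

omit [IsTopologicalGroup G] [DistribMulAction G S] [TopologicalSpace S] [DiscreteTopology S] in
/-- The push-forward `π ∘ z` of a continuous crossed homomorphism along an equivariant `π : M → Q`, as a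
continuous crossed homomorphism (`contOneCocycles.pullback` along `id_G`), evaluates as `π (z g)`.
[cite: SerreGaloisCohomology1997, I.§2.4] -/
theorem pullback_id_apply (π : M →+ Q) (hπ : ∀ (g : G) (m : M), π (g • m) = g • π m)
    (z : contOneCocycles (discreteTopRep G M)) (g : G) :
    (contOneCocycles.pullback (ContinuousMonoidHom.id G)
      (resHomOfEquivariant (ContinuousMonoidHom.id G) π hπ) z).1 g = π (z.1 g) :=
  rfl

omit [IsTopologicalGroup G] [DistribMulAction G S] [DistribMulAction G Q] [TopologicalSpace S]
  [DiscreteTopology S] [TopologicalSpace Q] [DiscreteTopology Q] [AddCommGroup S] [AddCommGroup Q] in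
/-- **A coboundary on `I` kills the elements of `I` acting trivially** (`z g = g • v − v = 0`): the reading
«the restricted homomorphism kills `N ∩ I`» of the engines' currency. [cite: SerreGaloisCohomology1997, I.§5.1] -/
theorem apply_eq_zero_of_coboundaryOn_of_forall_smul_eq (z : contOneCocycles (discreteTopRep G M))
    {I : Subgroup G} {v : M} (hv : ∀ g ∈ I, z.1 g = g • v - v) {g : G} (hg : g ∈ I)
    (htriv : ∀ m : M, g • m = m) : z.1 g = 0 := by
  rw [hv g hg, htriv v, sub_self]

omit [IsTopologicalGroup G] [DistribMulAction G Q] [TopologicalSpace Q] [DiscreteTopology Q]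
  [AddCommGroup Q] in
/-- **Exactness in the middle, on cocycles.** If `ι : S → M` is injective and equivariant and a continuous
crossed homomorphism `z' : G → M` takes all its values in `ι(S)`, then `z' = ι ∘ w` for a (unique) continuous
crossed homomorphism `w : G → S`. [cite: SerreGaloisCohomology1997, I.§2.2] -/
theorem exists_preimage_cocycle (ι : S →+ M) (hι : ∀ (g : G) (s : S), ι (g • s) = g • ι s)
    (hιinj : Function.Injective ι) (z' : contOneCocycles (discreteTopRep G M))
    (hval : ∀ g, ∃ s : S, ι s = z'.1 g) :
    ∃ w : contOneCocycles (discreteTopRep G S), ∀ g, ι (w.1 g) = z'.1 g := by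
  choose f hf using hval
  have hfcont : Continuous f := by
    rw [continuous_discrete_rng]
    intro s
    have hpre : f ⁻¹' {s} = z'.1 ⁻¹' {ι s} := by
      ext g
      simp only [Set.mem_preimage, Set.mem_singleton_iff]
      constructor
      · rintro rfl; exact (hf g).symm
      · intro h; exact hιinj ((hf g).trans h)
    rw [hpre]
    exact (isOpen_discrete _).preimage z'.1.continuous
  refine ⟨⟨⟨f, hfcont⟩, fun g h ↦ hιinj ?_⟩, fun g ↦ hf g⟩
  change ι (f (g * h)) = ι (f g + g • f h)
  rw [map_add, hι, hf, hf, hf]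
  exact cocycle_mul' z' g h

/-! ## §2 (α-core): an unramified class for the quotient or for the sub -/

/-- **(α-core) THE LEVEL DICTIONARY, CORE.** `G` a topological group; `S, M, Q` discrete `G`-modules, the orbit
maps of `M` continuous; `ι : S → M` and `π : M → Q` equivariant with `ι` injective, `π` surjective and
`ker π = im ι`; `𝓘` a family of subgroups of `G` such that for every `I ∈ 𝓘` either `Q` has no non-zero
`I`-invariant or `I` acts trivially on `M`. Let `z : G → M` be a continuous crossed homomorphism with NON-ZERO
class which is a coboundary on every `I ∈ 𝓘`. Then EITHER the push-forward `π ∘ z` has non-zero class in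
`H¹(G, Q)` and is a coboundary on every `I ∈ 𝓘`, OR there are a continuous crossed homomorphism `w : G → S`
with non-zero class in `H¹(G, S)`, a coboundary on every `I ∈ 𝓘`, and `m₁ ∈ M` with `ι (w g) = z g − (g • m₁ − m₁)`
for all `g`. (Application, LEAD g10 §2(d)(α): `M = W[p] ⊃ S = Φ`, `z = δ(P)` at level ≥ 1, `𝓘` = inertia at
`ℓ ≠ p` and decomposition at `p`; `Q^{I_ℓ} = 0` at additive `ℓ ≠ p`, `I_ℓ` trivial on `W[p]` at good `ℓ ≠ p`,
`Q^{D_p} = 0`.) [cite: SerreGaloisCohomology1997, I.§2.6 (b) and I.§5.1] [cite: GreenbergLNM1716, §3 (PDF p. 86)] -/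
theorem unramified_quot_or_sub_of_locally_trivial
    (hM : ∀ m : M, Continuous fun g : G ↦ g • m)
    (ι : S →+ M) (π : M →+ Q)
    (hι : ∀ (g : G) (s : S), ι (g • s) = g • ι s) (hπ : ∀ (g : G) (m : M), π (g • m) = g • π m)
    (hιinj : Function.Injective ι) (hπsurj : Function.Surjective π)
    (hπι : ∀ s, π (ι s) = 0) (hker : ∀ m, π m = 0 → ∃ s, ι s = m)
    (𝓘 : Set (Subgroup G))
    (hQ : ∀ I ∈ 𝓘, (∀ q : Q, (∀ g ∈ I, g • q = q) → q = 0) ∨ (∀ g ∈ I, ∀ m : M, g • m = m))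
    (z : contOneCocycles (discreteTopRep G M))
    (hz : oneCocycleClass (discreteTopRep G M) z ≠ 0)
    (hloc : ∀ I ∈ 𝓘, ∃ v : M, ∀ g ∈ I, z.1 g = g • v - v) :
    (oneCocycleClass (discreteTopRep G Q)
        (contOneCocycles.pullback (ContinuousMonoidHom.id G)
          (resHomOfEquivariant (ContinuousMonoidHom.id G) π hπ) z) ≠ 0 ∧
      ∀ I ∈ 𝓘, ∃ q : Q, ∀ g ∈ I,
        (contOneCocycles.pullback (ContinuousMonoidHom.id G)
          (resHomOfEquivariant (ContinuousMonoidHom.id G) π hπ) z).1 g = g • q - q) ∨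
    (∃ (w : contOneCocycles (discreteTopRep G S)) (m₁ : M),
      oneCocycleClass (discreteTopRep G S) w ≠ 0 ∧
      (∀ I ∈ 𝓘, ∃ s : S, ∀ g ∈ I, w.1 g = g • s - s) ∧
      ∀ g, ι (w.1 g) = z.1 g - (g • m₁ - m₁)) := by
  set zq := contOneCocycles.pullback (ContinuousMonoidHom.id G)
    (resHomOfEquivariant (ContinuousMonoidHom.id G) π hπ) z with hzq
  have hzq_apply : ∀ g, zq.1 g = π (z.1 g) := fun g ↦ rfl
  -- `π ∘ z` is a coboundary on every `I ∈ 𝓘`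
  have hqloc : ∀ I ∈ 𝓘, ∃ q : Q, ∀ g ∈ I, zq.1 g = g • q - q := by
    intro I hI
    obtain ⟨v, hv⟩ := hloc I hI
    exact ⟨π v, fun g hg ↦ by rw [hzq_apply, hv g hg, map_sub, hπ]⟩
  by_cases hq : oneCocycleClass (discreteTopRep G Q) zq ≠ 0
  · exact Or.inl ⟨hq, hqloc⟩
  right
  push Not at hq
  -- `π ∘ z = ∂q₀`, `q₀ = π m₁`
  obtain ⟨q₀, hq₀⟩ := (oneCocycleClass_eq_zero_iff _ zq).1 hq
  obtain ⟨m₁, hm₁⟩ := hπsurj q₀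
  -- the continuous coboundary `∂m₁` and `z' = z − ∂m₁`
  haveI : ContinuousSub M := ⟨continuous_of_discreteTopology⟩
  let b : contOneCocycles (discreteTopRep G M) :=
    ⟨⟨fun g ↦ g • m₁ - m₁, (hM m₁).sub continuous_const⟩, fun g h ↦ by
      change (g * h) • m₁ - m₁ = g • m₁ - m₁ + g • (h • m₁ - m₁)
      rw [mul_smul, smul_sub]
      abel⟩
  have hb : ∀ g, b.1 g = g • m₁ - m₁ := fun g ↦ rfl
  set z' : contOneCocycles (discreteTopRep G M) := z - b with hz'
  have hz'_apply : ∀ g, z'.1 g = z.1 g - (g • m₁ - m₁) := fun g ↦ rfl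
  -- `z'` takes values in `ker π = ι(S)`
  have hval : ∀ g, ∃ s : S, ι s = z'.1 g := by
    intro g
    apply hker
    rw [hz'_apply, map_sub, map_sub, hπ, hm₁, ← hzq_apply, hq₀ g]
    exact sub_self _
  obtain ⟨w, hw⟩ := exists_preimage_cocycle ι hι hιinj z' hval
  refine ⟨w, m₁, ?_, ?_, fun g ↦ by rw [hw, hz'_apply]⟩
  · -- `[w] ≠ 0`: else `z = ∂(m₁ + ι s₁)`
    intro hw0
    obtain ⟨s₁, hs₁⟩ := (oneCocycleClass_eq_zero_iff _ w).1 hw0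
    apply hz
    refine (oneCocycleClass_eq_zero_iff _ z).2 ⟨m₁ + ι s₁, fun g ↦ ?_⟩
    have h1 : ι (w.1 g) = z.1 g - (g • m₁ - m₁) := by rw [hw, hz'_apply]
    rw [hs₁ g] at h1
    change ι (g • s₁ - s₁) = _ at h1
    rw [map_sub, hι] at h1
    -- `h1 : g • ι s₁ - ι s₁ = z g - (g • m₁ - m₁)`
    change z.1 g = g • (m₁ + ι s₁) - (m₁ + ι s₁)
    rw [← eq_sub_iff_add_eq.mp h1, smul_add]
    abel
  · -- `w` is a coboundary on every `I ∈ 𝓘`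
    intro I hI
    obtain ⟨v, hv⟩ := hloc I hI
    -- `ι (w g) = g • u - u` on `I`, `u = v - m₁`
    have hu : ∀ g ∈ I, ι (w.1 g) = g • (v - m₁) - (v - m₁) := fun g hg ↦ by
      rw [hw, hz'_apply, hv g hg, smul_sub]
      abel
    -- `π u` is `I`-invariant
    have hπu : ∀ g ∈ I, g • π (v - m₁) = π (v - m₁) := fun g hg ↦ by
      have h := congrArg π (hu g hg)
      rw [hπι, map_sub, hπ] at h
      exact (sub_eq_zero.1 h.symm)
    rcases hQ I hI with hQI | htriv
    · -- `Q^I = 0`: `u = ι s₀`, `w = ∂s₀` on `I`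
      obtain ⟨s₀, hs₀⟩ := hker (v - m₁) (hQI _ hπu)
      refine ⟨s₀, fun g hg ↦ hιinj ?_⟩
      rw [hu g hg, ← hs₀, map_sub, hι]
    · -- `I` acts trivially on `M`: `w = 0` on `I`
      refine ⟨0, fun g hg ↦ hιinj ?_⟩
      rw [hu g hg, htriv g hg, sub_self, smul_zero, sub_zero, map_zero]

end Summit.BirchSwinnertonDyer.BirchSwinnertonDyer.Theorems.PrintCFram.LevelDictionary

end
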